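import Mathlib.RingTheory.DiscreteValuationRing.Basic
import Mathlib.RingTheory.PowerSeries.Inverse
import Mathlib.RingTheory.PowerSeries.Ideal
import Literature.NumberTheory.Automorphic.PadicIntermediateFieldUnitBall
import Literature.NumberTheory.Automorphic.PadicEmbeddingCoefficientRingComplete
import Literature.NumberTheory.EllipticCurves.GreenbergSelmerCharIdealPrincipalProofs
import Literature.NumberTheory.EllipticCurves.SharpFlatPAdicLFunctionCoeffField
import Summits.BirchSwinnertonDyer.BirchSwinnertonDyer.Theorems.ResidualThetaTransportAtTwoLambdaLowerBoundOAlgebra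
import HarnessLib

/-!
# `q^{λ_𝒪(X)} ≤ #(X/ϖX)` and «`X/ϖX` finite ⇒ `X` finitely generated over `𝒪`» for modules over
# `Λ_𝒪 = 𝒪⟦T⟧`, `𝒪 = 𝒪_E` the integers of a finite `E/ℚ_p` — the CM-side (S4) brick of crux (R≥)ᵖ

Route `ResidualThetaTransportAtTwo` (RTT), crux (R≥)ᵖ `ResidualThetaCountLowerPureAtTwo`
(stmt-BirchSwinnertonDyer-26074); seat `prover-bsd-wall-rtt-p2` g11 (`--supports`, closes nothing).
HONEST FRAMING: THEOREMS ONLY (no definition, no named fact, no instance, no `sorry`); pure commutative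
algebra; nothing about any Selmer group; BSD is not proved by any of this.

WHY (memo `Cruxes/ResidualThetaCountLowerPureAtTwo/LINE-DESIGN-g11.md` §2 (g)). On the CM side of the
crux the residual count `#Sel⁺_{S₀}(ℚ_∞, A_g)[ϖ] = #(X/ϖX)` (Pontryagin) must be turned into the
λ-lower bound `q^{λ_𝒪(X)} ≤ #(X/ϖX)`, `λ_𝒪(X) = rank_𝒪(X/X_tors) = dim_E (E ⊗_𝒪 X)`, for the
`Λ_𝒪 = 𝒪⟦T⟧`-dual `X`, `𝒪 = 𝒪_{ℚ₂(ι K_g)}`, `q = #(𝒪/ϖ)`. This is the `𝒪`-twin of the tree's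
`ℤ_p`-lemma `LambdaLowerBound.pow_finrank_baseChange_le_natCard_quotient` (p613549) and needs `X`
finitely generated OVER `𝒪` (= `μ = 0`), which on the CM side is NOT an input: it FOLLOWS from the
finiteness of `X/ϖX` (supplied by the transport from `W`) by Nakayama's lemma over the complete ring
`𝒪` for the `ϖ`-adically separated module `X` (generic part: companion file `…LambdaLowerBoundOAlgebra`).

WHAT.
* §3 `𝒪 = PadicIntermediateField.unitBall p E`, `E/ℚ_p` finite: `isDiscreteValuationRing_unitBall`,
  `coe_pow_smul_top_eq`, `isPrecomplete_span_prime_unitBall`, `exists_maximalIdeal_pow_eq_span_prime`,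
  **`isPrecomplete_maximalIdeal_unitBall`**, **`isAdicComplete_maximalIdeal_unitBall`** (`𝒪_E` is a
  complete DVR), `finite_quotient_span_prime_unitBall`, **`finite_quotient_maximalIdeal_unitBall`**
  (finite residue field), `map_maximalIdeal_le_powerSeries` (`𝔪_𝒪·𝒪⟦T⟧ ⊆ 𝔪_{𝒪⟦T⟧}`, any local `𝒪`).
* §5 **`moduleFinite_unitBall_of_finite_quotient`** (`X` f.g. over a Noetherian local `𝒪_E`-algebra `A`
  with `𝔪_𝒪 A ⊆ 𝔪_A`, `X/𝔪_𝒪X` finite ⇒ `X` f.g. over `𝒪_E`), **`pow_finrank_le_natCard_quotient_unitBall`**,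
  **`pow_finrank_le_natCard_quotient_of_powerSeries`** / `pow_finrank_quotientTorsion_le_natCard_quotient_of_powerSeries`:
  for `X` f.g. over `𝒪_E⟦T⟧` with `X/𝔪X` finite, `X` is f.g. over `𝒪_E` and
  `#(𝒪_E/𝔪)^{dim_E(E ⊗ X)} ≤ #(X/𝔪X)`.
* §6 the brick over the CRUX'S OWN CARRIERS `padicCoeffIntegers S` / `IwasawaAlgebraO S`
  (`S = Set.range ι`; `padicCoeffIntegers_eq_unitBall`): **`pow_finrank_le_natCard_quotient_of_iwasawaAlgebraO`**.

References: [NeukirchANT1999] Ch. II (4.8) (`𝒪_E` a complete DVR with finite residue field);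
[Matsumura1987] Thm. 8.4; [Washington1997] §13.2.
-/

set_option autoImplicit false
-- the Theorems namespace of this sub repeats the summit name by design (D-0017 nested layout)
set_option linter.dupNamespace false

noncomputable section

open scoped TensorProduct Pointwise

namespace Summit.BirchSwinnertonDyer.BirchSwinnertonDyer.Theorems.LambdaLowerBoundO

universe u v w

/-! ### §3. `𝒪 = 𝒪_E` for `E/ℚ_p` finite: a DVR, `𝔪`-adically complete, with finite residue field -/

section UnitBall

open Literature.NumberTheory.Automorphic

variable (p : ℕ) [Fact p.Prime] (E : IntermediateField ℚ_[p] (PadicAlgCl p))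

/-- **`𝒪_E` is a discrete valuation ring** (a local principal ideal domain in which `p ≠ 0` is not a
unit). [cite: NeukirchANT1999, Ch. II (4.8)] -/
theorem isDiscreteValuationRing_unitBall [FiniteDimensional ℚ_[p] E] :
    IsDiscreteValuationRing (PadicIntermediateField.unitBall p E) :=
  { not_a_field' := fun h => PadicIntermediateField.natCast_prime_ne_zero p E (by
      have hm := PadicIntermediateField.natCast_prime_mem_maximalIdeal p E
      rw [h, Ideal.mem_bot] at hm
      exact hm) }

/-- The `p`-adic filtrations of `𝒪_E` as a `ℤ_p`-module and as a ring agree: `pⁿ𝒪_E`.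
[folklore] -/
theorem coe_pow_smul_top_eq (n : ℕ) :
    (((IsLocalRing.maximalIdeal ℤ_[p]) ^ n • ⊤ :
        Submodule ℤ_[p] (PadicIntermediateField.unitBall p E)) :
          Set (PadicIntermediateField.unitBall p E)) =
      (((Ideal.span {((p : ℕ) : PadicIntermediateField.unitBall p E)}) ^ n • ⊤ :
        Submodule (PadicIntermediateField.unitBall p E) (PadicIntermediateField.unitBall p E)) :
          Set (PadicIntermediateField.unitBall p E)) := by
  rw [PadicInt.maximalIdeal_eq_span_p, Ideal.span_singleton_pow, Ideal.span_singleton_pow,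
    Submodule.ideal_span_singleton_smul, Submodule.ideal_span_singleton_smul]
  ext x
  simp only [SetLike.mem_coe, Submodule.mem_smul_pointwise_iff_exists]
  constructor
  · rintro ⟨y, -, rfl⟩
    refine ⟨y, Submodule.mem_top, ?_⟩
    rw [smul_eq_mul, Algebra.smul_def, map_pow, map_natCast]
  · rintro ⟨y, -, rfl⟩
    refine ⟨y, Submodule.mem_top, ?_⟩
    rw [smul_eq_mul, Algebra.smul_def, map_pow, map_natCast]

/-- **`𝒪_E` is `p`-adically precomplete** (it is finite free over the `p`-adically complete `ℤ_p`).
[cite: NeukirchANT1999, Ch. II (4.8)] -/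
theorem isPrecomplete_span_prime_unitBall [FiniteDimensional ℚ_[p] E] :
    IsPrecomplete (Ideal.span {((p : ℕ) : PadicIntermediateField.unitBall p E)})
      (PadicIntermediateField.unitBall p E) := by
  haveI : IsPrecomplete (IsLocalRing.maximalIdeal ℤ_[p]) (PadicIntermediateField.unitBall p E) :=
    isPrecomplete_of_free_finite (IsLocalRing.maximalIdeal ℤ_[p])
  exact isPrecomplete_of_forall_coe_eq _ _ (coe_pow_smul_top_eq p E)

/-- In `𝒪_E`, `(p) = 𝔪ᵉ` for some `e ≥ 1` (the ramification index). [cite: NeukirchANT1999, Ch. II (4.8)] -/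
theorem exists_maximalIdeal_pow_eq_span_prime [FiniteDimensional ℚ_[p] E] :
    ∃ e : ℕ, 0 < e ∧ (IsLocalRing.maximalIdeal (PadicIntermediateField.unitBall p E)) ^ e =
      Ideal.span {((p : ℕ) : PadicIntermediateField.unitBall p E)} := by
  haveI := isDiscreteValuationRing_unitBall p E
  obtain ⟨ϖ, hϖ⟩ := IsDiscreteValuationRing.exists_irreducible (PadicIntermediateField.unitBall p E)
  obtain ⟨e, u, hu⟩ := IsDiscreteValuationRing.eq_unit_mul_pow_irreducible
    (PadicIntermediateField.natCast_prime_ne_zero p E) hϖ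
  refine ⟨e, Nat.pos_of_ne_zero ?_, ?_⟩
  · rintro rfl
    rw [pow_zero, mul_one] at hu
    exact PadicIntermediateField.not_isUnit_natCast_prime p E (hu ▸ u.isUnit)
  · rw [(IsDiscreteValuationRing.irreducible_iff_uniformizer ϖ).1 hϖ, Ideal.span_singleton_pow, hu]
    exact (Ideal.span_singleton_mul_left_unit u.isUnit _).symm

/-- **`𝒪_E` is `𝔪`-adically precomplete.** [cite: NeukirchANT1999, Ch. II (4.8)] -/
theorem isPrecomplete_maximalIdeal_unitBall [FiniteDimensional ℚ_[p] E] :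
    IsPrecomplete (IsLocalRing.maximalIdeal (PadicIntermediateField.unitBall p E))
      (PadicIntermediateField.unitBall p E) := by
  haveI := isPrecomplete_span_prime_unitBall p E
  obtain ⟨e, he, hpow⟩ := exists_maximalIdeal_pow_eq_span_prime p E
  exact isPrecomplete_of_pow_le he hpow.le
    ((Ideal.span_singleton_le_iff_mem _).2 (PadicIntermediateField.natCast_prime_mem_maximalIdeal p E))

/-- **`𝒪_E` is `𝔪`-adically complete** (a complete discrete valuation ring).
[cite: NeukirchANT1999, Ch. II (4.8)] -/
theorem isAdicComplete_maximalIdeal_unitBall [FiniteDimensional ℚ_[p] E] :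
    IsAdicComplete (IsLocalRing.maximalIdeal (PadicIntermediateField.unitBall p E))
      (PadicIntermediateField.unitBall p E) :=
  { (inferInstance : IsHausdorff (IsLocalRing.maximalIdeal (PadicIntermediateField.unitBall p E))
      (PadicIntermediateField.unitBall p E)), isPrecomplete_maximalIdeal_unitBall p E with }

/-- `𝒪_E/p𝒪_E` is finite (`𝒪_E ≅ ℤ_pⁿ`). [cite: NeukirchANT1999, Ch. II (4.8)] -/
theorem finite_quotient_span_prime_unitBall [FiniteDimensional ℚ_[p] E] :
    Finite (PadicIntermediateField.unitBall p E ⧸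
      Ideal.span {((p : ℕ) : PadicIntermediateField.unitBall p E)}) := by
  -- as a `ℤ_p`-module quotient it is `𝒪/p𝒪`, finite; the two quotients have the same relation
  haveI : Finite (ℤ_[p] ⧸ IsLocalRing.maximalIdeal ℤ_[p]) :=
    Finite.of_equiv (ZMod p) (PadicInt.residueField (p := p)).symm.toEquiv
  haveI : Finite (PadicIntermediateField.unitBall p E ⧸
      (⊤ : Submodule ℤ_[p] (PadicIntermediateField.unitBall p E))) := by
    haveI : Subsingleton (PadicIntermediateField.unitBall p E ⧸
        (⊤ : Submodule ℤ_[p] (PadicIntermediateField.unitBall p E))) :=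
      Submodule.Quotient.subsingleton_iff.mpr rfl
    infer_instance
  haveI hfin : Finite (PadicIntermediateField.unitBall p E ⧸
      ((IsLocalRing.maximalIdeal ℤ_[p]) • ⊤ : Submodule ℤ_[p] (PadicIntermediateField.unitBall p E))) :=
    Submodule.finite_quotient_smul _ Module.Finite.fg_top
  have hrel : ∀ a b : PadicIntermediateField.unitBall p E,
      ((IsLocalRing.maximalIdeal ℤ_[p]) • ⊤ :
          Submodule ℤ_[p] (PadicIntermediateField.unitBall p E)).quotientRel a b ↔
        (Ideal.span {((p : ℕ) : PadicIntermediateField.unitBall p E)}).quotientRel a b := by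
    intro a b
    rw [Submodule.quotientRel_def, Submodule.quotientRel_def]
    have h := coe_pow_smul_top_eq p E 1
    simp only [pow_one] at h
    rw [← SetLike.mem_coe, h, SetLike.mem_coe, smul_eq_mul, Ideal.mul_top]
  exact Finite.of_equiv _ (Quotient.congr (Equiv.refl _) hrel)

/-- **The residue field of `𝒪_E` is finite.** [cite: NeukirchANT1999, Ch. II (4.8)] -/
theorem finite_quotient_maximalIdeal_unitBall [FiniteDimensional ℚ_[p] E] :
    Finite (PadicIntermediateField.unitBall p E ⧸
      IsLocalRing.maximalIdeal (PadicIntermediateField.unitBall p E)) := by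
  haveI := finite_quotient_span_prime_unitBall p E
  exact Finite.of_surjective
    (Ideal.Quotient.factor
      ((Ideal.span_singleton_le_iff_mem _).2 (PadicIntermediateField.natCast_prime_mem_maximalIdeal p E)))
    (Ideal.Quotient.factor_surjective _)

/-- `𝔪_𝒪 · 𝒪⟦T⟧ ⊆ 𝔪_{𝒪⟦T⟧}`: a power series whose coefficients lie in `𝔪_𝒪·𝒪⟦T⟧` has non-unit
constant term. [folklore] -/
theorem map_maximalIdeal_le_powerSeries {O : Type u} [CommRing O] [IsLocalRing O] :
    (IsLocalRing.maximalIdeal O).map (algebraMap O (PowerSeries O)) ≤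
      IsLocalRing.maximalIdeal (PowerSeries O) := by
  refine (IsLocalRing.le_maximalIdeal fun h => ?_)
  rw [Ideal.eq_top_iff_one] at h
  have : PowerSeries.constantCoeff (1 : PowerSeries O) ∈ IsLocalRing.maximalIdeal O := by
    refine Submodule.span_induction (p := fun f _ => PowerSeries.constantCoeff f ∈ IsLocalRing.maximalIdeal O)
      ?_ ?_ ?_ ?_ h
    · rintro _ ⟨a, ha, rfl⟩
      simpa using ha
    · simp
    · intro f g _ _ hf hg
      rw [map_add]
      exact add_mem hf hg
    · intro f g _ hg
      rw [smul_eq_mul, map_mul]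
      exact Ideal.mul_mem_left _ _ hg
  rw [map_one] at this
  exact (IsLocalRing.maximalIdeal.isMaximal O).ne_top (Ideal.eq_top_of_isUnit_mem _ this isUnit_one)

end UnitBall


/-! ### §5. The brick in the line's currency: modules over `𝒪_E` and over `Λ_{𝒪_E} = 𝒪_E⟦T⟧` -/

section CoeffRing

open Literature.NumberTheory.Automorphic

variable (p : ℕ) [Fact p.Prime] (E : IntermediateField ℚ_[p] (PadicAlgCl p)) [FiniteDimensional ℚ_[p] E]

/-- **`X/𝔪X` finite ⇒ `X` finitely generated over `𝒪_E`**, for `X` finitely generated over a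
Noetherian local `𝒪_E`-algebra `A` with `𝔪_{𝒪_E}·A ⊆ 𝔪_A` (e.g. `A = 𝒪_E⟦T⟧`): the CM side's
"`μ = 0`" is a CONSEQUENCE of the finiteness of the residual Selmer group, not an input.
[cite: Matsumura1987, Theorem 8.4] -/
theorem moduleFinite_unitBall_of_finite_quotient {A : Type v} [CommRing A]
    [Algebra (PadicIntermediateField.unitBall p E) A] [IsNoetherianRing A] [IsLocalRing A]
    (hA : (IsLocalRing.maximalIdeal (PadicIntermediateField.unitBall p E)).map
      (algebraMap (PadicIntermediateField.unitBall p E) A) ≤ IsLocalRing.maximalIdeal A)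
    (X : Type w) [AddCommGroup X] [Module A X] [Module (PadicIntermediateField.unitBall p E) X]
    [IsScalarTower (PadicIntermediateField.unitBall p E) A X] [Module.Finite A X]
    [Finite (X ⧸ ((IsLocalRing.maximalIdeal (PadicIntermediateField.unitBall p E)) • ⊤ :
      Submodule (PadicIntermediateField.unitBall p E) X))] :
    Module.Finite (PadicIntermediateField.unitBall p E) X := by
  haveI := isPrecomplete_maximalIdeal_unitBall p E
  exact moduleFinite_of_finite_quotient (A := A)
    (IsLocalRing.maximalIdeal (PadicIntermediateField.unitBall p E)) hA

/-- **`#(𝒪_E/𝔪)^{dim_E(E ⊗ X)} ≤ #(X/𝔪X)`** for every finitely generated `𝒪_E`-module `X`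
(`q^{λ_𝒪(X)} ≤ #(X/ϖX)`; torsion only enlarges the right side). [cite: Washington1997, §13.2] -/
theorem pow_finrank_le_natCard_quotient_unitBall (X : Type w) [AddCommGroup X]
    [Module (PadicIntermediateField.unitBall p E) X] [Module.Finite (PadicIntermediateField.unitBall p E) X] :
    Nat.card (PadicIntermediateField.unitBall p E ⧸
        IsLocalRing.maximalIdeal (PadicIntermediateField.unitBall p E)) ^
      Module.finrank E (E ⊗[PadicIntermediateField.unitBall p E] X) ≤
    Nat.card (X ⧸ ((IsLocalRing.maximalIdeal (PadicIntermediateField.unitBall p E)) • ⊤ :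
      Submodule (PadicIntermediateField.unitBall p E) X)) := by
  haveI : IsFractionRing (PadicIntermediateField.unitBall p E) E :=
    IsIntegralClosure.isFractionRing_of_finite_extension ℤ_[p] ℚ_[p] E
      (PadicIntermediateField.unitBall p E)
  haveI := PadicIntermediateField.isPrincipalIdealRing_unitBall p E
  haveI := finite_quotient_maximalIdeal_unitBall p E
  exact pow_finrank_baseChange_le_natCard_quotient E _ X

/-- **The (S4) brick of crux (R≥)ᵖ.** For a module `X` finitely generated over `Λ_{𝒪_E} = 𝒪_E⟦T⟧`
(with its `𝒪_E`-structure) whose reduction `X/𝔪_{𝒪_E}X` is finite: `X` is finitely generated over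
`𝒪_E` and `#(𝒪_E/𝔪)^{dim_E(E ⊗_{𝒪_E} X)} ≤ #(X/𝔪_{𝒪_E} X)`. Intended: `X = X⁺_{S₀}(g/ℚ_∞)`, the dual of
the CM form's plus Selmer group, `#(X/𝔪X) = #Sel[ϖ]` the residual count transported from `W`, and
`dim_E(E ⊗ X) = λ_𝒪(X) = d + Σ_g(S₀)` from the main conjecture. [cite: Washington1997, §13.2] -/
theorem pow_finrank_le_natCard_quotient_of_powerSeries (X : Type w) [AddCommGroup X]
    [Module (PowerSeries (PadicIntermediateField.unitBall p E)) X]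
    [Module (PadicIntermediateField.unitBall p E) X]
    [IsScalarTower (PadicIntermediateField.unitBall p E)
      (PowerSeries (PadicIntermediateField.unitBall p E)) X]
    [Module.Finite (PowerSeries (PadicIntermediateField.unitBall p E)) X]
    [Finite (X ⧸ ((IsLocalRing.maximalIdeal (PadicIntermediateField.unitBall p E)) • ⊤ :
      Submodule (PadicIntermediateField.unitBall p E) X))] :
    Module.Finite (PadicIntermediateField.unitBall p E) X ∧
      Nat.card (PadicIntermediateField.unitBall p E ⧸
          IsLocalRing.maximalIdeal (PadicIntermediateField.unitBall p E)) ^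
        Module.finrank E (E ⊗[PadicIntermediateField.unitBall p E] X) ≤
      Nat.card (X ⧸ ((IsLocalRing.maximalIdeal (PadicIntermediateField.unitBall p E)) • ⊤ :
        Submodule (PadicIntermediateField.unitBall p E) X)) := by
  haveI : Module.Finite (PadicIntermediateField.unitBall p E) X :=
    moduleFinite_unitBall_of_finite_quotient p E
      (A := PowerSeries (PadicIntermediateField.unitBall p E)) map_maximalIdeal_le_powerSeries X
  exact ⟨inferInstance, pow_finrank_le_natCard_quotient_unitBall p E X⟩

/-- The same with the `𝒪_E`-rank written intrinsically as `rank_{𝒪_E}(X/X_tors)` (`= dim_E(E ⊗ X)` by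
`finrank_baseChange_eq_finrank_quotientTorsion`; no fraction field in the statement).
[cite: Washington1997, §13.2] -/
theorem pow_finrank_quotientTorsion_le_natCard_quotient_of_powerSeries (X : Type w) [AddCommGroup X]
    [Module (PowerSeries (PadicIntermediateField.unitBall p E)) X]
    [Module (PadicIntermediateField.unitBall p E) X]
    [IsScalarTower (PadicIntermediateField.unitBall p E)
      (PowerSeries (PadicIntermediateField.unitBall p E)) X]
    [Module.Finite (PowerSeries (PadicIntermediateField.unitBall p E)) X]
    [Finite (X ⧸ ((IsLocalRing.maximalIdeal (PadicIntermediateField.unitBall p E)) • ⊤ :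
      Submodule (PadicIntermediateField.unitBall p E) X))] :
    Module.Finite (PadicIntermediateField.unitBall p E) X ∧
      Nat.card (PadicIntermediateField.unitBall p E ⧸
          IsLocalRing.maximalIdeal (PadicIntermediateField.unitBall p E)) ^
        Module.finrank (PadicIntermediateField.unitBall p E)
          (X ⧸ Submodule.torsion (PadicIntermediateField.unitBall p E) X) ≤
      Nat.card (X ⧸ ((IsLocalRing.maximalIdeal (PadicIntermediateField.unitBall p E)) • ⊤ :
        Submodule (PadicIntermediateField.unitBall p E) X)) := by
  obtain ⟨hfin, hle⟩ := pow_finrank_le_natCard_quotient_of_powerSeries p E X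
  haveI := hfin
  haveI : IsFractionRing (PadicIntermediateField.unitBall p E) E :=
    IsIntegralClosure.isFractionRing_of_finite_extension ℤ_[p] ℚ_[p] E
      (PadicIntermediateField.unitBall p E)
  haveI := PadicIntermediateField.isPrincipalIdealRing_unitBall p E
  rw [finrank_baseChange_eq_finrank_quotientTorsion E X] at hle
  exact ⟨hfin, hle⟩

end CoeffRing


/-! ### §6. The same brick over the crux's own carriers `padicCoeffIntegers S` and `IwasawaAlgebraO S` -/

section CruxCurrency

open Literature.NumberTheory.Automorphic Literature.NumberTheory.EllipticCurves

variable (p : ℕ) [Fact p.Prime] (E : IntermediateField ℚ_[p] (PadicAlgCl p)) [FiniteDimensional ℚ_[p] E]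

/-- §5 with the maximal ideal written as `(ϖ)` for a uniformiser `ϖ` of `𝒪_E` and the rank written as
`rank_{𝒪_E}(X/X_tors)`. [cite: Washington1997, §13.2] -/
theorem pow_finrank_le_natCard_quotient_of_powerSeries_span (ϖ : PadicIntermediateField.unitBall p E)
    (hϖ : Irreducible ϖ) (X : Type w) [AddCommGroup X]
    [Module (PowerSeries (PadicIntermediateField.unitBall p E)) X]
    [Module (PadicIntermediateField.unitBall p E) X]
    [IsScalarTower (PadicIntermediateField.unitBall p E)
      (PowerSeries (PadicIntermediateField.unitBall p E)) X]
    [Module.Finite (PowerSeries (PadicIntermediateField.unitBall p E)) X]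
    [hfin : Finite (X ⧸ ((Ideal.span {ϖ}) • ⊤ : Submodule (PadicIntermediateField.unitBall p E) X))] :
    Module.Finite (PadicIntermediateField.unitBall p E) X ∧
      Nat.card (PadicIntermediateField.unitBall p E ⧸ Ideal.span {ϖ}) ^
        Module.finrank (PadicIntermediateField.unitBall p E)
          (X ⧸ Submodule.torsion (PadicIntermediateField.unitBall p E) X) ≤
      Nat.card (X ⧸ ((Ideal.span {ϖ}) • ⊤ : Submodule (PadicIntermediateField.unitBall p E) X)) := by
  haveI := isDiscreteValuationRing_unitBall p E
  have hmax : IsLocalRing.maximalIdeal (PadicIntermediateField.unitBall p E) = Ideal.span {ϖ} :=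
    (IsDiscreteValuationRing.irreducible_iff_uniformizer ϖ).1 hϖ
  rw [← hmax] at hfin ⊢
  exact pow_finrank_quotientTorsion_le_natCard_quotient_of_powerSeries p E X

variable (S : Set (PadicAlgCl p)) [FiniteDimensional ℚ_[p] (padicCoeffField S)]

omit E [FiniteDimensional ℚ_[p] E] in
/-- **The (S4) brick over the crux's carriers.** For `𝒪 = padicCoeffIntegers S` (`S = Set.range ι`,
`ℚ_p(S)/ℚ_p` finite), a uniformiser `ϖ`, and a module `X` finitely generated over
`Λ_𝒪 = IwasawaAlgebraO S = 𝒪⟦T⟧` (with its `𝒪`-structure) such that `X/ϖX` is finite: `X` is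
finitely generated over `𝒪` and `#(𝒪/ϖ)^{rank_𝒪(X/X_tors)} ≤ #(X/ϖX)` (`rank_𝒪(X/X_tors) = λ_𝒪(X)
= dim (Frac 𝒪 ⊗_𝒪 X)`, `finrank_baseChange_eq_finrank_quotientTorsion`). Transport of §5 along
`padicCoeffIntegers_eq_unitBall`. [cite: Washington1997, §13.2] -/
theorem pow_finrank_le_natCard_quotient_of_iwasawaAlgebraO :
    ∀ (ϖ : padicCoeffIntegers S), Irreducible ϖ → ∀ (X : Type w) [AddCommGroup X]
      [Module (IwasawaAlgebraO S) X] [Module (padicCoeffIntegers S) X]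
      [IsScalarTower (padicCoeffIntegers S) (IwasawaAlgebraO S) X]
      [Module.Finite (IwasawaAlgebraO S) X]
      [Finite (X ⧸ ((Ideal.span {ϖ}) • ⊤ : Submodule (padicCoeffIntegers S) X))],
    Module.Finite (padicCoeffIntegers S) X ∧
      Nat.card (padicCoeffIntegers S ⧸ Ideal.span {ϖ}) ^
        Module.finrank (padicCoeffIntegers S) (X ⧸ Submodule.torsion (padicCoeffIntegers S) X) ≤
      Nat.card (X ⧸ ((Ideal.span {ϖ}) • ⊤ : Submodule (padicCoeffIntegers S) X)) := by
  unfold IwasawaAlgebraO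
  rw [padicCoeffIntegers_eq_unitBall S]
  intro ϖ hϖ X _ _ _ _ _ hfin
  exact pow_finrank_le_natCard_quotient_of_powerSeries_span p (padicCoeffField S) ϖ hϖ X

end CruxCurrency

end Summit.BirchSwinnertonDyer.BirchSwinnertonDyer.Theorems.LambdaLowerBoundO

end
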